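import Literature.NumberTheory.NumberFields.ClassGroupNormGalois
import HarnessLib

/-!
# Route BiquadraticEisensteinDescent — Klein-four descent of `p ∤ h` (odd `p`): if the three quadratic
# subfields of a biquadratic field have class number prime to `p`, so does the field
# (toward the admissibility conjunct of KS, item stmt-BirchSwinnertonDyer-20198)

The admissibility conjunct of the crux KS = `HeegnerFieldSupplyCMInertBadAdm` (and the hypothesis
`hadm` of E♭°/W♭/C′) is «`p ∤ h(M)` for every quartic `M ∋ √d_CM, √d_K′`», i.e. `p ∤ h(K_CM·K′)`.
The cell dossier (HEART-KS-DOSSIER v1.2 §4, Δ-h⁻) reduces it informally, via Kuroda/Herglotz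
`h_L = Q·h_K h_K′ h_F/2`, to `p ∤ h(K′)·h(F)` with `F = ℚ(√(d_CM·d_K′))` real quadratic. This file
proves the `p`-PRIMARY statement behind that reduction WITHOUT any class number formula, for an
arbitrary number field `M` carrying a Klein four-group `{1, σ₁, σ₂, σ₁σ₂}` of automorphisms:

* `mul_galois_smul_eq_extend_norm` — for `[M : F] = 2` with non-trivial `F`-automorphism `σ`:
  `c · σc = i_{M/F}(N_{M/F} c)` on ideal classes (the tree's `NumberField.mul_smul_eq_map_relNorm_of_finrank_eq_two`,
  Neukirch III (1.6)(iv), descended to `ClassGroup` with the tree's `classGroupNorm` / `classGroupExtend`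
  and the Galois action `ClassGroup.mulEquiv (AmbiguousClass.intAut σ)`);
* `galois_smul_eq_inv_of_not_dvd` — if `σ ≠ 1` is an involution of `M/ℚ` and `p ∤ h(M^σ)`, then `σ`
  INVERTS every `p`-torsion class of `M` (its norm to `M^σ` is killed by `p` and by `h(M^σ)`);
* **`not_dvd_classNumber_of_kleinFour`** — for commuting involutions `σ₁ ≠ σ₂` (both `≠ 1`) and an
  odd prime `p`: `p ∤ h(M^{σ₁})`, `p ∤ h(M^{σ₂})`, `p ∤ h(M^{σ₁σ₂})` ⟹ `p ∤ h(M)` (a class of order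
  `p` would satisfy `σ₁σ₂c = σ₁(c⁻¹) = c` and `σ₁σ₂ c = c⁻¹`, so `c² = 1`).

Theorem-only file (no definition, no named fact, no `sorry`), unconditional; helper toward KS
(`--supports` stmt-BirchSwinnertonDyer-20198), companion of `…AdmissibilityDescends.lean` (the
converse direction) and `…AdmissibilityOfQuadratic.lean` (the biquadratic field `ℚ(√a, √b)`).
Prover seat bsd-wall-bed-p2 (g6), 2026-08-27.

References: [NeukirchANT1999] Ch. III §1 Prop. (1.6) (ii), (iv); [Washington1997] §10.1–10.2
(`p`-parts of class groups under automorphisms of order prime to `p`); [Lemmermeyer1994]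
F. Lemmermeyer, *Kuroda's class number formula*, Acta Arith. 66 (1994) 245–260 (context only).
-/

set_option autoImplicit false

-- D-0017 layout: summit = sub-problem, so `Summit.BirchSwinnertonDyer.BirchSwinnertonDyer.…` is the mandated namespace.
set_option linter.dupNamespace false

open scoped NumberField Pointwise
open Module NumberField IntermediateField
open Literature.NumberTheory.NumberFields

namespace Summit.BirchSwinnertonDyer.BirchSwinnertonDyer.Theorems.BiquadraticEisensteinDescentHeegnerFieldSupplyAdmissibilityKleinFour

variable (M : Type) [Field M] [NumberField M]

/-- For an involution `σ ≠ 1` of a number field `M`, the fixed field of `⟨σ⟩` has `[M : M^σ] = 2`.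
[folklore] -/
theorem finrank_fixedField_zpowers_eq_two (σ : M ≃ₐ[ℚ] M) (h1 : σ ≠ 1) (h2 : σ * σ = 1) :
    finrank (fixedField (Subgroup.zpowers σ)) M = 2 := by
  haveI : Fact (Nat.Prime 2) := ⟨Nat.prime_two⟩
  rw [finrank_fixedField_eq_card, Nat.card_zpowers, orderOf_eq_prime (by rw [sq]; exact h2) h1]

/-- `σ` lies in the fixing subgroup of the fixed field of `⟨σ⟩`. [folklore] -/
theorem mem_fixingSubgroup_fixedField_zpowers (σ : M ≃ₐ[ℚ] M) :
    σ ∈ (fixedField (Subgroup.zpowers σ)).fixingSubgroup := by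
  rw [fixingSubgroup_fixedField]
  exact Subgroup.mem_zpowers σ

omit [NumberField M] in
/-- The Galois action of `σ` on an integral ideal is the image ideal under `intAut σ`. [folklore] -/
theorem galois_smul_ideal_eq_map {F : Type*} [Field F] [Algebra F M] (σ : M ≃ₐ[F] M)
    (J : Ideal (𝓞 M)) : σ • J = J.map (AmbiguousClass.intAut σ : 𝓞 M →+* 𝓞 M) := by
  rw [Ideal.pointwise_smul_def]
  congr 1

/-- **`c · σc = i_{M/F}(N_{M/F} c)` on ideal classes**, for `[M : F] = 2` and `σ` the non-trivial
`F`-automorphism of `M` (Neukirch III (1.6)(iv), quadratic case, on classes: the tree's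
`NumberField.mul_smul_eq_map_relNorm_of_finrank_eq_two` descended along `ClassGroup.mk0`).
[folklore] -/
theorem mul_galois_smul_eq_extend_norm {F : Type} [Field F] [NumberField F] [Algebra F M]
    (h2 : finrank F M = 2) (σ : M ≃ₐ[F] M) (hσ : σ ≠ 1) (c : ClassGroup (𝓞 M)) :
    c * ClassGroup.mulEquiv (AmbiguousClass.intAut σ) c =
      classGroupExtend F M (classGroupNorm F M c) := by
  obtain ⟨J, rfl⟩ := ClassGroup.mk0_surjective c
  rw [classGroupNorm_mk0, classGroupExtend_mk0, AmbiguousClass.mulEquiv_mk0, ← map_mul]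
  congr 1
  apply Subtype.ext
  rw [Submonoid.coe_mul]
  change (J : Ideal (𝓞 M)) * (J : Ideal (𝓞 M)).map (AmbiguousClass.intAut σ : 𝓞 M →+* 𝓞 M) =
    (Ideal.relNorm (𝓞 F) (J : Ideal (𝓞 M))).map (algebraMap (𝓞 F) (𝓞 M))
  rw [← galois_smul_ideal_eq_map M σ, NumberField.mul_smul_eq_map_relNorm_of_finrank_eq_two F M h2 σ hσ]

/-- **If `p ∤ h(M^σ)` then `σ` inverts the `p`-torsion of `Cl(M)`**: for an involution `σ ≠ 1` of
`M/ℚ`, `F = M^σ` and a class `c` with `c^p = 1`, `p ∤ h_F` forces `N_{M/F} c = 1`, hence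
`c · σc = i(N c) = 1`. [folklore] -/
theorem galois_smul_eq_inv_of_not_dvd (σ : M ≃ₐ[ℚ] M) (h1 : σ ≠ 1) (h2 : σ * σ = 1) {p : ℕ}
    (hp : p.Prime) (hF : ¬ p ∣ classNumber (fixedField (Subgroup.zpowers σ)))
    {c : ClassGroup (𝓞 M)} (hc : c ^ p = 1) :
    ClassGroup.mulEquiv (AmbiguousClass.intAut σ) c = c⁻¹ := by
  set F := fixedField (Subgroup.zpowers σ) with hFdef
  let σF : M ≃ₐ[F] M := fixingSubgroupEquiv F ⟨σ, mem_fixingSubgroup_fixedField_zpowers M σ⟩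
  have hσF : σF ≠ 1 := by
    intro h
    apply h1
    apply AlgEquiv.ext
    intro x
    have := AlgEquiv.congr_fun h x
    exact this
  -- the norm of `c` to `F` is killed by `p` and by `h_F`, hence trivial
  have hN : classGroupNorm F M c = 1 := by
    have hord : orderOf (classGroupNorm F M c) ∣ p :=
      orderOf_dvd_of_pow_eq_one (by rw [← map_pow, hc, map_one])
    have hcard : orderOf (classGroupNorm F M c) ∣ classNumber F := by
      rw [classNumber]; exact orderOf_dvd_card
    rcases (Nat.dvd_prime hp).mp hord with h | h
    · exact orderOf_eq_one_iff.mp h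
    · exact absurd (h ▸ hcard) hF
  have key := mul_galois_smul_eq_extend_norm M (finrank_fixedField_zpowers_eq_two M σ h1 h2) σF hσF c
  rw [hN, map_one] at key
  -- `intAut σF = intAut σ` definitionally (same underlying ring automorphism)
  have hint : AmbiguousClass.intAut σF = AmbiguousClass.intAut σ := rfl
  rw [hint] at key
  exact eq_inv_of_mul_eq_one_right key

/-- **Klein-four descent of `p ∤ h` (odd `p`).** Let `M` be a number field and `σ₁ ≠ σ₂` commuting
involutions of `M/ℚ`, both `≠ 1` (so `{1, σ₁, σ₂, σ₁σ₂}` is a Klein four-group of automorphisms,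
e.g. `M` biquadratic over `ℚ`), and `p` an odd prime. If the three fixed fields `M^{σ₁}`, `M^{σ₂}`,
`M^{σ₁σ₂}` all have class number prime to `p`, then so does `M`: a class `c` of order `p` would be
inverted by `σ₁`, `σ₂` and `σ₁σ₂`, but `σ₁σ₂ c = σ₁(c⁻¹) = c`, so `c = c⁻¹`, `c² = 1`, impossible for
odd `p`. (The `p`-primary form of Kuroda's class number relation `h_M = Q·h₁h₂h₃/(2h_ℚ²)`-type
statements; no class number formula is used.) [folklore] -/
theorem not_dvd_classNumber_of_kleinFour {p : ℕ} (hp : p.Prime) (hp2 : p ≠ 2)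
    (σ₁ σ₂ : M ≃ₐ[ℚ] M) (h₁ : σ₁ ≠ 1) (h₂ : σ₂ ≠ 1) (h₁₂ : σ₁ ≠ σ₂)
    (hs₁ : σ₁ * σ₁ = 1) (hs₂ : σ₂ * σ₂ = 1) (hcomm : σ₁ * σ₂ = σ₂ * σ₁)
    (hF₁ : ¬ p ∣ classNumber (fixedField (Subgroup.zpowers σ₁)))
    (hF₂ : ¬ p ∣ classNumber (fixedField (Subgroup.zpowers σ₂)))
    (hF₃ : ¬ p ∣ classNumber (fixedField (Subgroup.zpowers (σ₁ * σ₂)))) :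
    ¬ p ∣ classNumber M := by
  intro hdvd
  haveI : Fact p.Prime := ⟨hp⟩
  -- a class of order `p`
  obtain ⟨c, hc⟩ := exists_prime_orderOf_dvd_card p (by rwa [classNumber] at hdvd)
  have hcp : c ^ p = 1 := by rw [← hc]; exact pow_orderOf_eq_one c
  have h₃ : σ₁ * σ₂ ≠ 1 := by
    intro h
    apply h₁₂
    calc σ₁ = σ₁ * (σ₂ * σ₂) := by rw [hs₂, mul_one]
      _ = (σ₁ * σ₂) * σ₂ := by rw [mul_assoc]
      _ = σ₂ := by rw [h, one_mul]
  have hs₃ : (σ₁ * σ₂) * (σ₁ * σ₂) = 1 := by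
    calc (σ₁ * σ₂) * (σ₁ * σ₂) = σ₁ * (σ₂ * σ₁) * σ₂ := by simp only [mul_assoc]
      _ = σ₁ * (σ₁ * σ₂) * σ₂ := by rw [hcomm]
      _ = (σ₁ * σ₁) * (σ₂ * σ₂) := by simp only [mul_assoc]
      _ = 1 := by rw [hs₁, hs₂, one_mul]
  have e₁ := galois_smul_eq_inv_of_not_dvd M σ₁ h₁ hs₁ hp hF₁ hcp
  have e₂ := galois_smul_eq_inv_of_not_dvd M σ₂ h₂ hs₂ hp hF₂ hcp
  have e₃ := galois_smul_eq_inv_of_not_dvd M (σ₁ * σ₂) h₃ hs₃ hp hF₃ hcp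
  -- `σ₁σ₂ c = σ₁ (σ₂ c) = σ₁ c⁻¹ = c`
  rw [AmbiguousClass.mulEquiv_intAut_mul, MulEquiv.trans_apply, e₂, map_inv, e₁, inv_inv] at e₃
  -- `c = c⁻¹` with `c` of odd prime order: contradiction
  have hc2 : c ^ 2 = 1 := by rw [sq, ← eq_inv_iff_mul_eq_one]; exact e₃
  have hord : orderOf c ∣ 2 := orderOf_dvd_of_pow_eq_one hc2
  rw [hc] at hord
  exact hp2 ((Nat.prime_dvd_prime_iff_eq hp Nat.prime_two).mp hord)

variable {M} in
/-- An element fixed by `σ` lies in the fixed field of `⟨σ⟩`. [folklore] -/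
theorem mem_fixedField_zpowers_of_apply_eq {z : M} (σ : M ≃ₐ[ℚ] M) (hz : σ z = z) :
    z ∈ fixedField (Subgroup.zpowers σ) := by
  rw [IntermediateField.mem_fixedField_iff]
  intro f hf
  have h : Subgroup.zpowers σ ≤ MulAction.stabilizer (M ≃ₐ[ℚ] M) z :=
    (Subgroup.zpowers_le.mpr (MulAction.mem_stabilizer_iff.mpr hz))
  exact MulAction.mem_stabilizer_iff.mp (h hf)

end Summit.BirchSwinnertonDyer.BirchSwinnertonDyer.Theorems.BiquadraticEisensteinDescentHeegnerFieldSupplyAdmissibilityKleinFour
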